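import Summits.QuantumFields.YangMills.Theorems.SwapVirialDeficitBlowUpGnomonicFibreHessianPackage
import Summits.QuantumFields.YangMills.Theorems.SwapVirialDeficitQuantitativeLaplaceFibredChartCubicOn
import Summits.QuantumFields.YangMills.Theorems.SwapVirialDeficitBlowUpGnomonicFibreFarFloor
import Literature.Analysis.Asymptotics.LaplaceMethodMultivariate
import HarnessLib

/-!
# (S)-road, stub S2 — THE BULK FIBRED LAPLACE ESTIMATE OF SECTOR 000 IN THE GNOMONIC CHART, over an arbitrary measurable base set
# (free-hands support of ⟨stmt-QuantumFields-24197⟩ `SwapVirialDeficit.SwapGluedStiffness` ∕ ⟨24194⟩; the wiring of fcl-p3 g47's skeleton stub `stub_bulk_fibred`)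

For a hub `a ≠ 0`, good signs (`ε_z = +`, followers `+`), inverse temperature `b > 0`, a measurable base set `S ⊆ ℝ × ℝ` of axial letters `(x₀, y₀)` on which ONE
coercivity constant `μ′ > 0` is admissible (w3 g65's four growth constants), and a tube radius `R` with the two smallness conditions of the √b core: the cylinder
integral `∫_{(η_x 0, η_y 0) ∈ S} e^{−bF̂_{a,ε}(η)} ρ(η) dη` equals the Morse–Bott main term `(2π/b)^{α} ∫_{p∈S} 𝔪(a,ε,p) dp`,
`𝔪 = ρ(gnoBase p)·(2π)^{−α}·∫_{V_L} e^{−½Q_p}` (`Q_p(y) = (d²/ds²)F̂(gnoBase p + s·gnoFibreEmb y)|₀`, `α = dim V_L/2 = 9L⁴ − 1`), up to the relative error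
`K₃(μ′,R,L)/√b + 16(m+8)/(μ′R²b)` and the absolute off-tube term `e^{−bμ′R²}·∫ρ`.

* §1 letters: `gnoFibre_offTube_floor` (w3's off-tube floor on `V_L`), `gnoCylinder_eq_image` (the cylinder `{(η_x 0, η_y 0) ∈ S}` is `gnoFibreEquiv(S × V_L)`),
  `integral_cylinder_eq_integral_withDensity` (the cylinder integral as `∫ e^{−b(F̂−0)}·𝟙_C d(vol·ρ)`), `measureReal_volume_gnoDensity_univ` (`(vol·ρ)(GnoCoord L) = ∫ρ`),
  `mbDensity_eq_of_coercive` (`ρ(gnoBase p)/√det(A p) = 𝔪(p)`: ✓`integral_exp_neg_half_inner_self'`);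
* §2 ★★★ `bulk_fibred_cylinder` — the estimate above (✓`laplaceMethod_quantitative_fibred_chart_cubic_offBound_on` fed with ✓`gnoFibre_bulk_sockets`,
  ✓`volume_gnoDensity_restrict_tube_eq_map`, ✓`offTube_bound_of_cylinder` + ✓`exists_of_mem_cylinder_not_mem_tube` + w3's floor).

What is NOT here: the specialisation `S := BaseBox V₀`, `μ′ := λ(ψ₀, V₀, L)`, `R := μ′/(8(m+8)·414000L⁴)` with the polynomial domination of the constants by
`K·L^k·(V₀/ψ₀)^k` (g47's letters `boxIntegral`, `mbDensity`, `HubBulk`; part 2 of this file, appended next), the tip∕ends, sector `001`.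
HONEST LABEL: wiring of landed results; ⟨24197⟩ ∕ ⟨24194⟩ (window-uniform) OPEN; own crux ⟨22884⟩ OPEN (blocked-on ⟨19935⟩); no crux, rung of record or summit is proved;
the Yang–Mills mass gap is NOT proved; no summit is proved by a line.  Width seat ym-line-sfw-p2-w2 g59 (cell ym-idea-1, free hands), `--supports stmt-QuantumFields-24197`.
THEOREMS ONLY (0 `def`, 0 `sorry`), standard axioms.  References: [cite: Luscher1983, §2]; [cite: HasenpflugRudolfSprungk2024, App. 4.1 Thm 16]; [cite: Breitung1994, Lemma 26];
[folklore].
-/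

set_option autoImplicit false
set_option synthInstance.maxSize 1024

noncomputable section

open MeasureTheory Quaternion Set Metric Module
open scoped BigOperators Quaternion ContDiff InnerProductSpace ENNReal
open Literature.MathematicalPhysics.QuantumFieldTheory hiding SU2
open Literature.MathematicalPhysics.QuantumLattice

namespace Summit.QuantumFields.YangMills.Theorems.SwapVirialDeficit.BlowUpRing

open Summit.QuantumFields.YangMills.Theorems.FemtoTransferGap
open Summit.QuantumFields.YangMills.Theorems.FemtoTransferGap.TT
open Summit.QuantumFields.YangMills.Theorems.VirialFluxGap.RingDeficit
open Summit.QuantumFields.YangMills.Theorems.SwapVirialDeficit.SwapRing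
open Summit.QuantumFields.YangMills.Theorems.SwapVirialDeficit.Gnomonic (normSq3)
open Summit.QuantumFields.YangMills.Theorems.QuantitativeLaplace (laplaceMethod_quantitative_fibred_chart_cubic_offBound_on offTube_bound_of_cylinder)

variable {L : ℕ} [NeZero L]

/-! ## §1 Letters -/

/-- ★ **w3's off-tube floor on the Euclidean fibre**: hub `a ≠ 0`, follower signs `+`, `0 ≤ μ′` below the four growth constants at `(x₀, y₀)`, `0 ≤ R ≤ 1`; then
`R ≤ ‖y‖ ⟹ μ′R² ≤ F̂(gnoBase x₀ y₀ + gnoFibreEmb y)` (✓`fibre_offTube_floor_gnomonic` ∘ ✓`norm_sq_gnoFibre`). [cite: Luscher1983, §2] -/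
theorem gnoFibre_offTube_floor {a : ℍ} (ha : a ≠ 0) (ε : GnoSign L) (hε : ε.2.2 = fun _ => true) (x₀ y₀ : ℝ) {μ' R : ℝ} (hμ0 : 0 ≤ μ')
    (hR : 0 ≤ R) (hR1 : R ≤ 1)
    (hμx : μ' ≤ 2 * (2 * (‖a‖⁻¹ * a.re) * (‖a‖⁻¹ * ‖a.im‖)) ^ 2 / ((2 + x₀ ^ 2) * (16200 * (L : ℝ) ^ 6)))
    (hμy : μ' ≤ 2 * (‖a‖⁻¹ * ‖a.im‖) ^ 2 / ((2 + y₀ ^ 2) * (16200 * (L : ℝ) ^ 6)))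
    (hμz : μ' ≤ 1 / (16200 * (L : ℝ) ^ 6))
    (hμF : μ' ≤ (2304 * (L : ℝ) ^ 6 * (Fintype.card (Fol L) : ℝ))⁻¹ / 2)
    (y : GnoFibre L) (hfar : R ≤ ‖y‖) :
    μ' * R ^ 2 ≤ gnoDeficit (fun _ => false) (fun _ => 1) a ε (gnoBase x₀ y₀ + gnoFibreEmb y) := by
  have hN : R ^ 2 ≤ (gnoFibreBlocks y).1.1 0 ^ 2 + (gnoFibreBlocks y).1.1 1 ^ 2 + ((gnoFibreBlocks y).1.2 0 ^ 2 + (gnoFibreBlocks y).1.2 1 ^ 2) +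
      normSq3 (gnoFibreBlocks y).2.1 + ∑ f, normSq3 ((gnoFibreBlocks y).2.2 f) := by
    rw [← norm_sq_gnoFibre]; exact pow_le_pow_left₀ hR hfar 2
  rw [gnoFibreEmb_eq_fibreDir]
  exact fibre_offTube_floor_gnomonic ha ε hε x₀ y₀ hμ0 hR hR1 hμx hμy hμz hμF (gnoFibreBlocks y) hN

/-- The cylinder over a base set in gnomonic letters is the image `gnoFibreEquiv(S × V_L)`. [folklore] -/
theorem gnoCylinder_eq_image (S : Set (ℝ × ℝ)) :
    {η : GnoCoord L | (η.1.1 0, η.1.2 0) ∈ S} = gnoFibreEquiv '' (S ×ˢ (univ : Set (GnoFibre L))) :=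
  (gnoFibreEquiv_image_prod_univ S).symm

/-- `(vol·ρ)(GnoCoord L)`, as a real number, is `∫ ρ`. [folklore] -/
theorem measureReal_volume_gnoDensity_univ :
    ((volume : Measure (GnoCoord L)).withDensity fun η => ENNReal.ofReal (gnoDensity η)).real univ = ∫ η : GnoCoord L, gnoDensity η := by
  rw [measureReal_def, withDensity_apply _ MeasurableSet.univ, Measure.restrict_univ,
    ← ofReal_integral_eq_lintegral_ofReal (integrable_gnoDensity (L := L)) (Filter.Eventually.of_forall fun η => (gnoDensity_pos η).le),
    ENNReal.toReal_ofReal (integral_nonneg fun η => (gnoDensity_pos η).le)]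

/-- The cylinder integral `∫ 𝟙_C·e^{−bF̂}·ρ dvol` is the integral of `e^{−b(F̂−0)}·𝟙_C` against `vol·ρ`. [folklore] -/
theorem integral_cylinder_eq_integral_withDensity (F : GnoCoord L → ℝ) (b : ℝ) (C : Set (GnoCoord L)) :
    ∫ η : GnoCoord L, C.indicator (fun η => Real.exp (-(b * F η)) * gnoDensity η) η =
      ∫ η, Real.exp (-(b * (F η - 0))) * C.indicator (fun _ => (1 : ℝ)) η ∂((volume : Measure (GnoCoord L)).withDensity fun η => ENNReal.ofReal (gnoDensity η)) := by
  rw [integral_withDensity_eq_integral_toReal_smul (f := fun η : GnoCoord L => ENNReal.ofReal (gnoDensity η)) measurable_gnoDensity.ennreal_ofReal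
    (Filter.Eventually.of_forall fun η => ENNReal.ofReal_lt_top)]
  refine integral_congr_ae (Filter.Eventually.of_forall fun η => ?_)
  dsimp only
  rw [ENNReal.toReal_ofReal (gnoDensity_pos η).le, smul_eq_mul, sub_zero]
  by_cases hη : η ∈ C
  · rw [indicator_of_mem hη, indicator_of_mem hη]; ring
  · rw [indicator_of_notMem hη, indicator_of_notMem hη]; ring

/-- ★ **THE MORSE–BOTT DENSITY THROUGH THE DETERMINANT**: for a symmetric operator `A` on `V_L`, coercive (`0 < μ′`, `μ′‖y‖² ≤ ⟪Ay,y⟫`), with the ray identity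
`⟪Ay,y⟫ = Q(y)`: `w/√det A = w·((2π)^{dim V_L/2})⁻¹·∫_{V_L} e^{−Q/2}` (✓`integral_exp_neg_half_inner_self'`). [cite: Breitung1994, Lemma 26 (2.102), p. 30] -/
theorem mbDensity_eq_of_coercive {A : GnoFibre L →ₗ[ℝ] GnoFibre L} (hA : A.IsSymmetric) {μ' : ℝ} (hμ : 0 < μ') (hcoer : ∀ y : GnoFibre L, μ' * ‖y‖ ^ 2 ≤ ⟪A y, y⟫_ℝ)
    {Q : GnoFibre L → ℝ} (hQ : ∀ y, ⟪A y, y⟫_ℝ = Q y) (w : ℝ) :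
    w / Real.sqrt (LinearMap.det A) =
      w * ((2 * Real.pi) ^ ((finrank ℝ (GnoFibre L) : ℝ) / 2))⁻¹ * ∫ y : GnoFibre L, Real.exp (-(Q y / 2)) := by
  have hpos : ∀ y : GnoFibre L, y ≠ 0 → 0 < ⟪A y, y⟫_ℝ := fun y hy =>
    lt_of_lt_of_le (mul_pos hμ (by positivity)) (hcoer y)
  have hG := Literature.Analysis.Asymptotics.integral_exp_neg_half_inner_self' hA hpos
  have hfun : (fun y : GnoFibre L => Real.exp (-(Q y / 2))) = fun y => Real.exp (-(1 / 2) * ⟪A y, y⟫_ℝ) := by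
    funext y; rw [hQ]; congr 1; ring
  have hc : (0 : ℝ) < (2 * Real.pi) ^ ((finrank ℝ (GnoFibre L) : ℝ) / 2) := by positivity
  rw [hfun, hG]
  field_simp

/-! ## §2 The bulk estimate over a measurable base set -/

/-- ★★★ **THE BULK FIBRED LAPLACE ESTIMATE OF SECTOR 000, CYLINDER FORM.**  Hub `a ≠ 0`, good signs (`ε_z = +`, followers `+`); `S ⊆ ℝ × ℝ` measurable containing
`p₀`; `0 < μ′` admissible at every `(x₀,y₀) ∈ S` (w3 g65's four growth constants); `0 < R ≤ 1` with `414000L⁴·R ≤ μ′/(8(m+8))` and `2R·R ≤ 1` (`m = dim V_L = 18L⁴ − 2`);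
`0 < b`.  Then, with `Main := (2π/b)^{m/2}·∫_{p∈S} ρ(gnoBase p)·((2π)^{m/2})⁻¹·∫_{V_L} e^{−½Q_p}` and
`K₃ := 16A₃(m+8)/μ′ + 256A₃(m+8)²/μ′² + 2R + 16R(m+8)/μ′` (`A₃ = 414000L⁴`):
`|∫_{(η_x0,η_y0)∈S} e^{−bF̂}ρ − Main| ≤ (K₃/√b + 16(m+8)/(μ′R²b))·Main + e^{−bμ′R²}·∫ρ`.
[cite: Luscher1983, §2] [cite: HasenpflugRudolfSprungk2024, App. 4.1 Thm 16] -/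
theorem bulk_fibred_cylinder {a : ℍ} (ha : a ≠ 0) (ε : GnoSign L) (hz : ε.2.1 = true) (hε : ε.2.2 = fun _ => true)
    {S : Set (ℝ × ℝ)} (hS : MeasurableSet S) {p₀ : ℝ × ℝ} (hp₀ : p₀ ∈ S) (hSi : IntegrableOn (fun p : ℝ × ℝ => gnoDensity (gnoBase p.1 p.2 : GnoCoord L)) S)
    {μ' : ℝ} (hμ : 0 < μ')
    (hμx : ∀ p ∈ S, μ' ≤ 2 * (2 * (‖a‖⁻¹ * a.re) * (‖a‖⁻¹ * ‖a.im‖)) ^ 2 / ((2 + p.1 ^ 2) * (16200 * (L : ℝ) ^ 6)))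
    (hμy : ∀ p ∈ S, μ' ≤ 2 * (‖a‖⁻¹ * ‖a.im‖) ^ 2 / ((2 + p.2 ^ 2) * (16200 * (L : ℝ) ^ 6)))
    (hμz : μ' ≤ 1 / (16200 * (L : ℝ) ^ 6))
    (hμF : μ' ≤ (2304 * (L : ℝ) ^ 6 * (Fintype.card (Fol L) : ℝ))⁻¹ / 2)
    {R b : ℝ} (hR : 0 < R) (hR1 : R ≤ 1) (hsmall : 414000 * (L : ℝ) ^ 4 * R ≤ μ' / (8 * ((finrank ℝ (GnoFibre L) : ℝ) + 8))) (hDR : 2 * R * R ≤ 1)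
    (hb : 0 < b) :
    |(∫ η : GnoCoord L, {η : GnoCoord L | (η.1.1 0, η.1.2 0) ∈ S}.indicator
          (fun η => Real.exp (-(b * gnoDeficit (fun _ => false) (fun _ => 1) a ε η)) * gnoDensity η) η) -
        (2 * Real.pi / b) ^ ((finrank ℝ (GnoFibre L) : ℝ) / 2) *
          ∫ p in S, gnoDensity (gnoBase p.1 p.2 : GnoCoord L) * ((2 * Real.pi) ^ ((finrank ℝ (GnoFibre L) : ℝ) / 2))⁻¹ *
            ∫ y : GnoFibre L, Real.exp (-(iteratedDeriv 2 (fun s : ℝ => gnoDeficit (fun _ => false) (fun _ => 1) a ε (gnoBase p.1 p.2 + s • gnoFibreEmb y)) 0 / 2))| ≤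
      ((16 * (414000 * (L : ℝ) ^ 4) * ((finrank ℝ (GnoFibre L) : ℝ) + 8) / μ' + 256 * (414000 * (L : ℝ) ^ 4) * ((finrank ℝ (GnoFibre L) : ℝ) + 8) ^ 2 / μ' ^ 2 +
            2 * R + 8 * (2 * R) * ((finrank ℝ (GnoFibre L) : ℝ) + 8) / μ') / Real.sqrt b +
          16 * ((finrank ℝ (GnoFibre L) : ℝ) + 8) / (μ' * R ^ 2) / b) *
        ((2 * Real.pi / b) ^ ((finrank ℝ (GnoFibre L) : ℝ) / 2) *
          ∫ p in S, gnoDensity (gnoBase p.1 p.2 : GnoCoord L) * ((2 * Real.pi) ^ ((finrank ℝ (GnoFibre L) : ℝ) / 2))⁻¹ *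
            ∫ y : GnoFibre L, Real.exp (-(iteratedDeriv 2 (fun s : ℝ => gnoDeficit (fun _ => false) (fun _ => 1) a ε (gnoBase p.1 p.2 + s • gnoFibreEmb y)) 0 / 2))) +
      Real.exp (-(b * (μ' * R ^ 2))) * ∫ η : GnoCoord L, gnoDensity η := by
  -- the measure space and the sockets
  set μρ : Measure (GnoCoord L) := (volume : Measure (GnoCoord L)).withDensity fun η => ENNReal.ofReal (gnoDensity η) with hμρ
  haveI : IsFiniteMeasure μρ := isFiniteMeasure_volume_gnoDensity
  obtain ⟨A, ρ, e, hAs, hAm, hρm, hem, hray, -, hf, hρb, hw, heb, hcoer⟩ := gnoFibre_bulk_sockets (L := L) ha ε hz hε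
  set C : Set (GnoCoord L) := gnoFibreEquiv '' (S ×ˢ (univ : Set (GnoFibre L))) with hC
  set φ : GnoCoord L → ℝ := C.indicator (fun _ => (1 : ℝ)) with hφ
  have hCm : MeasurableSet C := measurableSet_cylinder hS
  have hφm : Measurable φ := measurable_const.indicator hCm
  -- coercivity on `S`
  have hcoerS : ∀ p ∈ S, ∀ y : GnoFibre L, μ' * ‖y‖ ^ 2 ≤ ⟪A p y, y⟫_ℝ := fun p hp y =>
    hcoer p.1 p.2 μ' hμ (hμx p hp) (hμy p hp) hμz hμF y
  -- the tube chart identity and the tube image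
  obtain ⟨hTm, hchart⟩ := volume_gnoDensity_restrict_tube_eq_map (L := L) hS R
  -- the amplitude on the cylinder
  have hw' : ∀ p ∈ S, ∀ y : GnoFibre L, ‖y‖ ≤ R → gnoDensity (gnoFibreEquiv (p, y)) * φ (gnoFibreEquiv (p, y)) = gnoDensity (gnoBase p.1 p.2 : GnoCoord L) * (1 + e (p, y)) := by
    intro p hp y _
    have hmem : gnoFibreEquiv (p, y) ∈ C := ⟨(p, y), ⟨hp, mem_univ _⟩, rfl⟩
    rw [hφ, indicator_of_mem hmem]
    exact hw p y
  -- the off-tube bound on the product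
  have hoff : ∀ x, x ∉ gnoFibreEquiv '' (S ×ˢ closedBall (0 : GnoFibre L) R) →
      ‖Real.exp (-(b * (gnoDeficit (fun _ => false) (fun _ => 1) a ε x - 0))) * φ x‖ ≤ 1 * Real.exp (-(b * (μ' * R ^ 2))) := by
    refine offTube_bound_of_cylinder (C := C) hb.le (fun x hx => by rw [hφ, indicator_of_notMem hx]) zero_le_one
      (fun x hx => by rw [hφ, indicator_of_mem hx, abs_one]) fun x hx hxT => ?_
    obtain ⟨p, hp, y, hRy, rfl⟩ := exists_of_mem_cylinder_not_mem_tube hx hxT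
    rw [zero_add]
    exact gnoFibre_offTube_floor ha ε hε p.1 p.2 hμ.le hR.le hR1 (hμx p hp) (hμy p hp) hμz hμF y hRy.le
  -- the generic √b law on the base set `S`
  obtain ⟨-, hbd⟩ := laplaceMethod_quantitative_fibred_chart_cubic_offBound_on (X := GnoCoord L) (μ := μρ) (M := ℝ × ℝ) (ν := volume) (V := GnoFibre L)
    (Ψ := gnoFibreEquiv) (J := fun q => gnoDensity (gnoFibreEquiv q)) (f := gnoDeficit (fun _ => false) (fun _ => 1) a ε) (φ := φ) (f₀ := 0)
    hS hp₀ (A := A) (fun p _ => hAs p) hμ hcoerS hAm (R := R) (A₃ := 414000 * (L : ℝ) ^ 4) (D := 2 * R) (β := b) (Eoff := 1 * Real.exp (-(b * (μ' * R ^ 2))))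
    hR (by positivity) (by positivity) hb hsmall hDR measurable_gnoFibreEquiv hTm (measurable_gnoDensity.comp measurable_gnoFibreEquiv)
    (fun z _ => (gnoDensity_pos _).le) hchart (measurable_gnoDeficit _ _ a ε) hφm hρm hem
    ((gnoDensity_gnoBase_pos_continuous (L := L)).2.measurable) (fun p _ => (gnoDensity_pos _).le) hSi
    (fun p _ y _ => hρb p y) (fun p _ y hy => heb R hR.le p y hy) (fun p _ y _ => hf p y) hw' (by positivity) (Filter.Eventually.of_forall hoff)
  -- read the generic conclusion in the cylinder letters
  rw [one_mul, measureReal_volume_gnoDensity_univ] at hbd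
  have hmain : ∫ p in S, gnoDensity (gnoBase p.1 p.2 : GnoCoord L) / Real.sqrt (LinearMap.det (A p)) =
      ∫ p in S, gnoDensity (gnoBase p.1 p.2 : GnoCoord L) * ((2 * Real.pi) ^ ((finrank ℝ (GnoFibre L) : ℝ) / 2))⁻¹ *
        ∫ y : GnoFibre L, Real.exp (-(iteratedDeriv 2 (fun s : ℝ => gnoDeficit (fun _ => false) (fun _ => 1) a ε (gnoBase p.1 p.2 + s • gnoFibreEmb y)) 0 / 2)) :=
    setIntegral_congr_fun hS fun p hp => mbDensity_eq_of_coercive (hAs p) hμ (hcoerS p hp) (fun y => hray p y) _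
  rw [hmain, ← integral_cylinder_eq_integral_withDensity, hC, ← gnoCylinder_eq_image] at hbd
  exact hbd

end Summit.QuantumFields.YangMills.Theorems.SwapVirialDeficit.BlowUpRing

end
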